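import Mathlib.Algebra.BigOperators.Group.Finset.Basic
import Literature.Computability.MetaComplexity.PartialBijections

/-!
# Route «KPlusLogSqLaw», crux `TropicalB` (stmt-ValiantsHypothesis-19771) — THE AUGMENTING-PATH EXCHANGE FOR BIPARTITE MATCHINGS

HONEST FRAMING.  Helper toward the registered stubs `stub_tropThin` / `stub_tropFat` of `Cruxes/TropicalB/Lines/birth.lean`
(crux `Summit.ValiantsHypothesis.ValiantsHypothesis.Theses.KPlusLogSqLaw.TropicalB`, item stmt-ValiantsHypothesis-19771, route
KPlusLogSqLaw; cell `pub-symmetroid`, seat val-sym-trop-p1 g8, 2026-08-27; `--supports … --as helper`).  A COMBINATORIAL ENGINE about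
matchings of an arbitrary bipartite graph; nothing here bounds `TropicalB`, and nothing bears on `WeakLifting`, DoorA26 / DoorA34,
`MatrixDescartes` (stmt-ValiantsHypothesis-18050) or VP ≠ VNP.

THE POINT.  In a dominance design whose slope classes are SEPARATED (class-`l` valuations on the scale `d_l`, `d_{l+1} ≫ m·d_l`) the
dominant chain is a lexicographic tower of LEVELS, and when class `0` is present on every entry each level `l ≥ 1` is the parametric
`k`-MATCHING problem `θ ↦ max_k (θ·k + ω_k(U))`, `ω_k(U)` = the maximum weight of a `k`-matching of the class-`l` edges inside the
vertex set `U` left over by the higher levels (seat memo SEPARATED-LEVELS-g8.md, evidence on the item).  Its breakpoints are the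
marginal values of `k ↦ ω_k(U)`, and the sector analysis («a carry at a higher level moves the lower digit by at most one unit per
deleted vertex», hence NO digit multiplication in that sector) rests on exchange facts about the valuation `(k, U) ↦ ω_k(U)` —
concavity in `k` and INTERLACING under vertex deletion (the M♮-concavity of the assignment valuation: Murota's network induction;
Shapley's substitutes property of the assignment game).  All of them are instances of ONE exchange lemma, proved here from scratch on
`Finset (α × β)` matchings in the tree's vocabulary `Literature.Computability.MetaComplexity.PBij.IsPMatching` / `dom` / `rng`:

* conclusion shape (an EXCHANGE of `(M₁, M₂)`): matchings `N₁, N₂` with `N₁ ∪ N₂ = M₁ ∪ M₂`, `N₁ ∩ N₂ = M₁ ∩ M₂` (the same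
  multiset of edges, so weights add up for EVERY weight), `|N₁| = |M₁| + 1`, `dom M₁ ⊆ dom N₁`, `rng M₁ ⊆ rng N₁`;
* `exchange` — **AUGMENTING-PATH EXCHANGE**: matchings `M₁`, `M₂` with `|M₁| < |M₂|` admit an exchange (`N₁ = M₁ Δ P`, `N₂ = M₂ Δ P`
  for an `M₁`-augmenting path `P ⊆ M₁ Δ M₂`).  The proof is an induction on `|M₁ ∖ M₂|` that walks the path one swap at a time
  (`exchange_aux`): take a row `u` of `M₂` unused by `M₁` and its edge `(u, b) ∈ M₂`; if column `b` is free in `M₁` move the edge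
  over (`exchange_fresh`); otherwise `(a, b) ∈ M₁`, and the swapped matching `M₁ − (a,b) + (u,b)` is one edge closer to `M₂`, so
  induction gives an exchange for it, which is repaired at the single edge `(u, b) ↦ (a, b)` on whichever side keeps both matchings.

The consequences (weights, concavity, interlacing under row/column deletion) are in …TropicalBMatchingInterlacing.
[folklore: Berge 1957 (alternating paths); Murota, Discrete Convex Analysis (2003) §9; Shapley 1962]
-/

set_option linter.dupNamespace false
set_option autoImplicit false

namespace Summit.ValiantsHypothesis.ValiantsHypothesis.Theorems.KPlusLogSqLaw

namespace MatchingExchange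

open Finset
open scoped BigOperators
open Literature.Computability.MetaComplexity.PBij

variable {α β : Type*} [DecidableEq α] [DecidableEq β]

/-! ### Small facts about matchings -/

/-- In a matching, erasing the edge at column `b` frees column `b`. [folklore] -/
theorem not_mem_rng_erase {N : Finset (α × β)} (hN : IsPMatching N) {u : α} {b : β} (he : (u, b) ∈ N) :
    b ∉ rng (N.erase (u, b)) := by
  intro hb
  obtain ⟨x, hx⟩ := mem_rng.1 hb
  rw [Finset.mem_erase] at hx
  exact hx.1 (Prod.ext (hN.eq_of_snd_eq hx.2 he) rfl)

/-- In a matching, erasing the edge at row `a` frees row `a`. [folklore] -/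
theorem not_mem_dom_erase {N : Finset (α × β)} (hN : IsPMatching N) {a : α} {y : β} (he : (a, y) ∈ N) :
    a ∉ dom (N.erase (a, y)) := by
  intro ha
  obtain ⟨x, hx⟩ := mem_dom.1 ha
  rw [Finset.mem_erase] at hx
  exact hx.1 (Prod.ext rfl (hN.eq_of_fst_eq hx.2 he))

/-- The FRESH-EDGE case of the exchange: an edge of `M₂` whose row and column are unused by `M₁` is moved over. [folklore] -/
theorem exchange_fresh {M₁ M₂ : Finset (α × β)} (h₁ : IsPMatching M₁) (h₂ : IsPMatching M₂) {u : α} {b : β}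
    (he : (u, b) ∈ M₂) (hu : u ∉ dom M₁) (hb : b ∉ rng M₁) :
    IsPMatching (insert (u, b) M₁) ∧ IsPMatching (M₂.erase (u, b)) ∧ insert (u, b) M₁ ∪ M₂.erase (u, b) = M₁ ∪ M₂ ∧
      insert (u, b) M₁ ∩ M₂.erase (u, b) = M₁ ∩ M₂ ∧ (insert (u, b) M₁).card = M₁.card + 1 ∧
      dom M₁ ⊆ dom (insert (u, b) M₁) ∧ rng M₁ ⊆ rng (insert (u, b) M₁) := by
  have hnot : (u, b) ∉ M₁ := fun h => hu (mem_dom.2 ⟨b, h⟩)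
  refine ⟨h₁.insert hu hb, h₂.subset (Finset.erase_subset _ _), ?_, ?_, ?_, ?_, ?_⟩
  · ext x
    simp only [Finset.mem_union, Finset.mem_insert, Finset.mem_erase]
    by_cases hx : x = (u, b)
    · subst hx; simp [he]
    · simp [hx]
  · ext x
    simp only [Finset.mem_inter, Finset.mem_insert, Finset.mem_erase]
    by_cases hx : x = (u, b)
    · subst hx; simp [hnot]
    · simp [hx]
  · exact Finset.card_insert_of_notMem hnot
  · exact dom_mono (Finset.subset_insert _ _)
  · exact rng_mono (Finset.subset_insert _ _)

/-- **AUGMENTING-PATH EXCHANGE** (induction form, on `|M₁ \ M₂|`). [folklore: Berge 1957] -/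
theorem exchange_aux : ∀ (n : ℕ) (M₁ M₂ : Finset (α × β)), (M₁ \ M₂).card = n → IsPMatching M₁ → IsPMatching M₂ →
    M₁.card < M₂.card → ∃ N₁ N₂ : Finset (α × β), IsPMatching N₁ ∧ IsPMatching N₂ ∧ N₁ ∪ N₂ = M₁ ∪ M₂ ∧ N₁ ∩ N₂ = M₁ ∩ M₂ ∧
      N₁.card = M₁.card + 1 ∧ dom M₁ ⊆ dom N₁ ∧ rng M₁ ⊆ rng N₁ := by
  intro n
  induction n with
  | zero =>
    intro M₁ M₂ hn h₁ h₂ hlt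
    -- a row of `M₂` unused by `M₁`
    have hlt' : (dom M₁).card < (dom M₂).card := by rw [h₁.card_dom, h₂.card_dom]; exact hlt
    obtain ⟨u, hu₂, hu₁⟩ := Finset.exists_mem_notMem_of_card_lt_card hlt'
    obtain ⟨b, hub⟩ := mem_dom.1 hu₂
    by_cases hb : b ∈ rng M₁
    · -- impossible: `M₁ ⊆ M₂`
      exfalso
      obtain ⟨a, hab⟩ := mem_rng.1 hb
      have hsub : M₁ ⊆ M₂ := by
        intro x hx
        by_contra hx2
        have : x ∈ M₁ \ M₂ := Finset.mem_sdiff.2 ⟨hx, hx2⟩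
        rw [Finset.card_eq_zero.1 hn] at this
        simp at this
      have hau : a = u := h₂.eq_of_snd_eq (hsub hab) hub
      exact hu₁ (mem_dom.2 ⟨b, hau ▸ hab⟩)
    · exact ⟨_, _, exchange_fresh h₁ h₂ hub hu₁ hb⟩
  | succ n ih =>
    intro M₁ M₂ hn h₁ h₂ hlt
    have hlt' : (dom M₁).card < (dom M₂).card := by rw [h₁.card_dom, h₂.card_dom]; exact hlt
    obtain ⟨u, hu₂, hu₁⟩ := Finset.exists_mem_notMem_of_card_lt_card hlt'
    obtain ⟨b, hub⟩ := mem_dom.1 hu₂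
    by_cases hb : b ∈ rng M₁
    swap
    · exact ⟨_, _, exchange_fresh h₁ h₂ hub hu₁ hb⟩
    -- the column `b` of `e₂ = (u, b) ∈ M₂` is used by `M₁` through `e₁ = (a, b)`: walk one step along the path
    obtain ⟨a, hab⟩ := mem_rng.1 hb
    have hau : a ≠ u := fun h => hu₁ (mem_dom.2 ⟨b, h ▸ hab⟩)
    have he2M1 : (u, b) ∉ M₁ := fun h => hu₁ (mem_dom.2 ⟨b, h⟩)
    have he1M2 : (a, b) ∉ M₂ := fun h => hau (h₂.eq_of_snd_eq h hub)
    have hne12 : (a, b) ≠ (u, b) := fun h => hau (Prod.mk.inj h).1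
    -- the swapped matching `M₁' = M₁ − e₁ + e₂`
    set M₁' : Finset (α × β) := insert (u, b) (M₁.erase (a, b)) with hM₁'
    have hE : IsPMatching (M₁.erase (a, b)) := h₁.subset (Finset.erase_subset _ _)
    have huE : u ∉ dom (M₁.erase (a, b)) := fun h => hu₁ (dom_mono (Finset.erase_subset _ _) h)
    have hbE : b ∉ rng (M₁.erase (a, b)) := not_mem_rng_erase h₁ hab
    have h₁' : IsPMatching M₁' := hE.insert huE hbE
    have he2E : (u, b) ∉ M₁.erase (a, b) := fun h => he2M1 (Finset.mem_of_mem_erase h)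
    have hcard' : M₁'.card = M₁.card := by
      rw [hM₁', Finset.card_insert_of_notMem he2E, Finset.card_erase_of_mem hab]
      have : 0 < M₁.card := Finset.card_pos.2 ⟨_, hab⟩
      omega
    have hmem' : ∀ x, x ∈ M₁' ↔ x = (u, b) ∨ (x ≠ (a, b) ∧ x ∈ M₁) := by
      intro x; rw [hM₁', Finset.mem_insert, Finset.mem_erase]
    have hsdiff : (M₁' \ M₂).card = n := by
      have hx : M₁' \ M₂ = (M₁ \ M₂).erase (a, b) := by
        ext x
        rw [Finset.mem_sdiff, hmem', Finset.mem_erase, Finset.mem_sdiff]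
        constructor
        · rintro ⟨hx | ⟨hx1, hx2⟩, hx3⟩
          · exact absurd hub (hx ▸ hx3)
          · exact ⟨hx1, hx2, hx3⟩
        · rintro ⟨hx1, hx2, hx3⟩
          exact ⟨Or.inr ⟨hx1, hx2⟩, hx3⟩
      rw [hx, Finset.card_erase_of_mem (Finset.mem_sdiff.2 ⟨hab, he1M2⟩), hn]
      rfl
    obtain ⟨N₁', N₂', hN₁', hN₂', hU, hI, hc, hdom, hrng⟩ := ih M₁' M₂ hsdiff h₁' h₂ (hcard' ▸ hlt)
    -- `e₂` lies in both `N₁'` and `N₂'`, `e₁` in neither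
    have he2I : (u, b) ∈ N₁' ∩ N₂' := by
      rw [hI, Finset.mem_inter]; exact ⟨(hmem' _).2 (Or.inl rfl), hub⟩
    have he2N1 : (u, b) ∈ N₁' := (Finset.mem_inter.1 he2I).1
    have he2N2 : (u, b) ∈ N₂' := (Finset.mem_inter.1 he2I).2
    have he1U : (a, b) ∉ N₁' ∪ N₂' := by
      rw [hU, Finset.mem_union, hmem']
      rintro ((h | ⟨h, _⟩) | h)
      · exact hne12 h
      · exact h rfl
      · exact he1M2 h
    have he1N1 : (a, b) ∉ N₁' := fun h => he1U (Finset.mem_union_left _ h)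
    have he1N2 : (a, b) ∉ N₂' := fun h => he1U (Finset.mem_union_right _ h)
    have haM1' : a ∉ dom M₁' := by
      intro h
      obtain ⟨y, hy⟩ := mem_dom.1 h
      rcases (hmem' _).1 hy with hy | ⟨hy1, hy2⟩
      · exact hau (Prod.mk.inj hy).1
      · exact hy1 (Prod.ext rfl (h₁.eq_of_fst_eq hy2 hab))
    -- pointwise bookkeeping shared by both options
    have hUx : ∀ x, (x ∈ N₁' ∨ x ∈ N₂') ↔ (x ∈ M₁' ∨ x ∈ M₂) := fun x => by
      rw [← Finset.mem_union, ← Finset.mem_union, hU]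
    have hIx : ∀ x, (x ∈ N₁' ∧ x ∈ N₂') ↔ (x ∈ M₁' ∧ x ∈ M₂) := fun x => by
      rw [← Finset.mem_inter, ← Finset.mem_inter, hI]
    by_cases haN1 : a ∈ dom N₁'
    · -- OPTION Y: keep `N₁'`, repair `N₂'` (swap `e₂` back to `e₁` there)
      have haN2 : a ∉ dom (N₂'.erase (u, b)) := by
        intro h
        obtain ⟨y, hy⟩ := mem_dom.1 h
        have hy2 : (a, y) ∈ N₂' := Finset.mem_of_mem_erase hy
        obtain ⟨x, hx⟩ := mem_dom.1 haN1
        -- both `(a, x)` and `(a, y)` come from `M₂` (row `a` is unused by `M₁'`)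
        have hxM2 : (a, x) ∈ M₂ := by
          rcases (hUx _).1 (Or.inl hx) with h | h
          · exact absurd (mem_dom.2 ⟨x, h⟩) haM1'
          · exact h
        have hyM2 : (a, y) ∈ M₂ := by
          rcases (hUx _).1 (Or.inr hy2) with h | h
          · exact absurd (mem_dom.2 ⟨y, h⟩) haM1'
          · exact h
        have hxy : x = y := h₂.eq_of_fst_eq hxM2 hyM2
        subst hxy
        have : (a, x) ∈ M₁' := ((hIx _).1 ⟨hx, hy2⟩).1
        exact haM1' (mem_dom.2 ⟨x, this⟩)
      have hbN2 : b ∉ rng (N₂'.erase (u, b)) := not_mem_rng_erase hN₂' he2N2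
      refine ⟨N₁', insert (a, b) (N₂'.erase (u, b)),
        hN₁', (hN₂'.subset (Finset.erase_subset _ _)).insert haN2 hbN2, ?_, ?_, ?_, ?_, ?_⟩
      · ext x
        rw [Finset.mem_union, Finset.mem_insert, Finset.mem_erase, Finset.mem_union]
        by_cases hx1 : x = (a, b)
        · subst hx1; exact iff_of_true (Or.inr (Or.inl rfl)) (Or.inl hab)
        by_cases hx2 : x = (u, b)
        · subst hx2; exact iff_of_true (Or.inl he2N1) (Or.inr hub)
        have k2 : x ∈ M₁' ↔ x ∈ M₁ := by
          rw [hmem']; exact ⟨fun h => h.elim (fun e => absurd e hx2) (fun e => e.2), fun h => Or.inr ⟨hx1, h⟩⟩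
        have k1 := hUx x; rw [k2] at k1
        constructor
        · rintro (h | h | ⟨_, h⟩)
          · exact k1.1 (Or.inl h)
          · exact absurd h hx1
          · exact k1.1 (Or.inr h)
        · intro h
          rcases k1.2 h with h' | h'
          · exact Or.inl h'
          · exact Or.inr (Or.inr ⟨hx2, h'⟩)
      · ext x
        rw [Finset.mem_inter, Finset.mem_insert, Finset.mem_erase, Finset.mem_inter]
        by_cases hx1 : x = (a, b)
        · subst hx1; exact iff_of_false (fun h => he1N1 h.1) (fun h => he1M2 h.2)
        by_cases hx2 : x = (u, b)
        · subst hx2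
          exact iff_of_false (fun h => h.2.elim (fun e => hne12 e.symm) (fun e => e.1 rfl)) (fun h => he2M1 h.1)
        have k2 : x ∈ M₁' ↔ x ∈ M₁ := by
          rw [hmem']; exact ⟨fun h => h.elim (fun e => absurd e hx2) (fun e => e.2), fun h => Or.inr ⟨hx1, h⟩⟩
        have kI := hIx x; rw [k2] at kI
        constructor
        · rintro ⟨h, h' | ⟨_, h'⟩⟩
          · exact absurd h' hx1
          · exact kI.1 ⟨h, h'⟩
        · intro h
          obtain ⟨n1, n2⟩ := kI.2 h
          exact ⟨n1, Or.inr ⟨hx2, n2⟩⟩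
      · rw [hc, hcard']
      · intro x hx
        obtain ⟨y, hy⟩ := mem_dom.1 hx
        by_cases hxa : x = a
        · exact hxa ▸ haN1
        · have : (x, y) ∈ M₁' := (hmem' _).2 (Or.inr ⟨fun h => hxa (Prod.mk.inj h).1, hy⟩)
          exact hdom (mem_dom.2 ⟨y, this⟩)
      · intro y hy
        obtain ⟨x, hx⟩ := mem_rng.1 hy
        by_cases hyb : y = b
        · exact hrng (mem_rng.2 ⟨u, hyb ▸ (hmem' _).2 (Or.inl rfl)⟩)
        · have : (x, y) ∈ M₁' := (hmem' _).2 (Or.inr ⟨fun h => hyb (Prod.mk.inj h).2, hx⟩)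
          exact hrng (mem_rng.2 ⟨x, this⟩)
    · -- OPTION X: repair `N₁'` (swap `e₂` to `e₁` there), keep `N₂'`
      have haE : a ∉ dom (N₁'.erase (u, b)) := fun h => haN1 (dom_mono (Finset.erase_subset _ _) h)
      have hbE' : b ∉ rng (N₁'.erase (u, b)) := not_mem_rng_erase hN₁' he2N1
      refine ⟨insert (a, b) (N₁'.erase (u, b)), N₂',
        (hN₁'.subset (Finset.erase_subset _ _)).insert haE hbE', hN₂', ?_, ?_, ?_, ?_, ?_⟩
      · ext x
        rw [Finset.mem_union, Finset.mem_insert, Finset.mem_erase, Finset.mem_union]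
        by_cases hx1 : x = (a, b)
        · subst hx1; exact iff_of_true (Or.inl (Or.inl rfl)) (Or.inl hab)
        by_cases hx2 : x = (u, b)
        · subst hx2; exact iff_of_true (Or.inr he2N2) (Or.inr hub)
        have k2 : x ∈ M₁' ↔ x ∈ M₁ := by
          rw [hmem']; exact ⟨fun h => h.elim (fun e => absurd e hx2) (fun e => e.2), fun h => Or.inr ⟨hx1, h⟩⟩
        have k1 := hUx x; rw [k2] at k1
        constructor
        · rintro ((h | ⟨_, h⟩) | h)
          · exact absurd h hx1
          · exact k1.1 (Or.inl h)
          · exact k1.1 (Or.inr h)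
        · intro h
          rcases k1.2 h with h' | h'
          · exact Or.inl (Or.inr ⟨hx2, h'⟩)
          · exact Or.inr h'
      · ext x
        rw [Finset.mem_inter, Finset.mem_insert, Finset.mem_erase, Finset.mem_inter]
        by_cases hx1 : x = (a, b)
        · subst hx1; exact iff_of_false (fun h => he1N2 h.2) (fun h => he1M2 h.2)
        by_cases hx2 : x = (u, b)
        · subst hx2
          exact iff_of_false (fun h => h.1.elim (fun e => hne12 e.symm) (fun e => e.1 rfl)) (fun h => he2M1 h.1)
        have k2 : x ∈ M₁' ↔ x ∈ M₁ := by
          rw [hmem']; exact ⟨fun h => h.elim (fun e => absurd e hx2) (fun e => e.2), fun h => Or.inr ⟨hx1, h⟩⟩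
        have kI := hIx x; rw [k2] at kI
        constructor
        · rintro ⟨h | ⟨_, h⟩, h'⟩
          · exact absurd h hx1
          · exact kI.1 ⟨h, h'⟩
        · intro h
          obtain ⟨n1, n2⟩ := kI.2 h
          exact ⟨Or.inr ⟨hx2, n1⟩, n2⟩
      · have he1E : (a, b) ∉ N₁'.erase (u, b) := fun h => he1N1 (Finset.mem_of_mem_erase h)
        rw [Finset.card_insert_of_notMem he1E, Finset.card_erase_of_mem he2N1, hc, hcard']
        omega
      · intro x hx
        obtain ⟨y, hy⟩ := mem_dom.1 hx
        by_cases hxa : x = a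
        · subst hxa; exact mem_dom.2 ⟨b, Finset.mem_insert_self _ _⟩
        · have hxy : (x, y) ∈ M₁' := (hmem' _).2 (Or.inr ⟨fun h => hxa (Prod.mk.inj h).1, hy⟩)
          obtain ⟨y', hy'⟩ := mem_dom.1 (hdom (mem_dom.2 ⟨y, hxy⟩))
          have hxu : x ≠ u := fun h => hu₁ (mem_dom.2 ⟨y, h ▸ hy⟩)
          refine mem_dom.2 ⟨y', Finset.mem_insert_of_mem (Finset.mem_erase.2 ⟨fun h => hxu (Prod.mk.inj h).1, hy'⟩)⟩
      · intro y hy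
        obtain ⟨x, hx⟩ := mem_rng.1 hy
        by_cases hyb : y = b
        · subst hyb; exact mem_rng.2 ⟨a, Finset.mem_insert_self _ _⟩
        · have hxy : (x, y) ∈ M₁' := (hmem' _).2 (Or.inr ⟨fun h => hyb (Prod.mk.inj h).2, hx⟩)
          obtain ⟨x', hx'⟩ := mem_rng.1 (hrng (mem_rng.2 ⟨x, hxy⟩))
          refine mem_rng.2 ⟨x', Finset.mem_insert_of_mem (Finset.mem_erase.2 ⟨fun h => hyb (Prod.mk.inj h).2, hx'⟩)⟩

/-- **AUGMENTING-PATH EXCHANGE.**  For matchings `M₁`, `M₂` with `|M₁| < |M₂|` there are matchings `N₁`, `N₂` with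
`N₁ ∪ N₂ = M₁ ∪ M₂`, `N₁ ∩ N₂ = M₁ ∩ M₂`, `|N₁| = |M₁| + 1`, `dom M₁ ⊆ dom N₁`, `rng M₁ ⊆ rng N₁`. [folklore: Berge 1957] -/
theorem exchange {M₁ M₂ : Finset (α × β)} (h₁ : IsPMatching M₁) (h₂ : IsPMatching M₂) (hlt : M₁.card < M₂.card) :
    ∃ N₁ N₂ : Finset (α × β), IsPMatching N₁ ∧ IsPMatching N₂ ∧ N₁ ∪ N₂ = M₁ ∪ M₂ ∧ N₁ ∩ N₂ = M₁ ∩ M₂ ∧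
      N₁.card = M₁.card + 1 ∧ dom M₁ ⊆ dom N₁ ∧ rng M₁ ⊆ rng N₁ :=
  exchange_aux _ M₁ M₂ rfl h₁ h₂ hlt

end MatchingExchange

end Summit.ValiantsHypothesis.ValiantsHypothesis.Theorems.KPlusLogSqLaw
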